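import Summits.Ventures.CertifiedArithmetic.LowPrec.SRPythagorasVariance
import HarnessLib

/-!
# SR accumulation with few random bits, CXII: the mean map is monotone — nonnegative mean gaps,
and the variance conjecture on every certified class

HONEST FRAMING: certified error envelopes and provably optimal rounding/accumulation schemes for
low-precision formats under stated cost models; every table by two implementations; no hardware or
vendor claims.

Setting of CX `SRPythagorasNoise` / CXI `SRPythagorasVariance`: recursive summation
`ŝₖ₊₁ = round_q(ŝₖ + xₖ)` of fixed summands into a finite value set `F` with a limited-randomness
rule `q` (up-probability `pUpQ`, sign branch), exact expectations over the full outcome tree.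

1. STOCHASTIC MONOTONICITY OF ONE LIMITED-RANDOMNESS STEP (`stepQ_mono_arg`).  If `q` maps
   `[0,1]` into `[0,1]` and is nondecreasing there, then for every nondecreasing `f` the one-step
   expectation `c ↦ E f(round_q c)` is nondecreasing in the pre-rounding value `c` — on an
   ARBITRARY finite value set, with saturation, on both sides of zero (on the negative side the
   rule acts on `1 − θ` and the up-probability is `1 − q(1 − θ)`, again nondecreasing).  Exact SR
   is LXXVIII `SRMonotone.step_mono_arg`; the content here is that ANY monotone rule inherits it,
   in particular `StochasticA` = truncation of the residual to `N` bits
   (`probAwayA_monotone`: `θ ↦ ⌊2^N θ⌋/2^N` is nondecreasing).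
2. THE MEAN MAP IS MONOTONE (`accExpQ_mono_arg`): `s ↦ E[f(ŝₙ) | ŝ₀ = s]` is nondecreasing for
   every nondecreasing `f`, every `n`, every summand sequence.  Hence every MEAN GAP of CXI is
   NONNEGATIVE, `0 ≤ D(c) = E[ŝₙ | up c] − E[ŝₙ | dn c]` (`meanGap_nonneg`), and CX's sibling
   drift gap satisfies `−w ≤ Δ(c)` (`neg_width_le_driftGap`): rounding up instead of down never
   LOWERS the expected result.  (Certificate `gen20/var`: `0` negative mean gaps on 46 540 trees —
   now a theorem for every tree of every monotone rule.)
3. THE VARIANCE CONJECTURE ON EVERY CERTIFIED CLASS.  With `0 ≤ D`, the one-sided mean-gap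
   criterion `MeanGapLE G` (`D ≤ G` at every node) bounds every node variance,
   `π(1−π)·D² ≤ G²/4` (`nodeVar_le_of_meanGap_le`), hence
   `MeanGapLE G ⇒ Var ŝₙ = E Σ π(1−π)D² ≤ n·G²/4` (`varQ_le_of_meanGapLE`) and
   `GapLE G ∧ DriftAntitone ⇒ Var ŝₙ ≤ n·G²/4` (`varQ_le_of_driftAntitone`), for every monotone
   admissible rule on every value set.  For `StochasticA` on a one-signed nested window with top
   spacing `G = 2^J·g` this puts CXI's conjecture `VAR-LE : Var ŝₙ ≤ n·G²/4` — the strongest form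
   of the Pythagorean law, which implies `NOISE-LE` and the mean-square law
   `n·G²/4 + (n·2^{-N}·G)²` (CXI `stochasticA_acc_sq_le_of_varQ_le`) — on exactly the classes
   where the law is already a theorem: the `N`-binade locality condition `JumpLE` of CVII
   (`varQ_le_of_jumpLE`), hence `N ≥ J` random bits (`varQ_le_of_le`, XCIV's regime), descending
   accumulations (CVIII) and bounded growth (CIX) through their `JumpLE` certificates.  So far the
   certified classes carried the mean-square law only; the variance bound `n·G²/4` WITHOUT the
   bias term is new for them and is the statement the certificates test (`0` violations on all
   46 540 trees, certified or not).
4. Kernel instances (namespace `Formats`, E3M2, two random bits): CVII's six-step descent from `28`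
   through five binades has `Var ŝ₆ = 90111/65536 ≤ 24 = 6·G²/4` (by item 3 from its `JumpLE`
   certificate, and the exact value by evaluation); CX's tree `xNB` (not `MeanGapLE`) has all mean
   gaps in `[0, 17/8]`: nonnegative as item 2 demands, above `G = 2` as CXI showed.

What this does NOT do: it does not prove `VAR-LE` beyond `MeanGapLE` trees (CXI's `xNB` has
`Var ŝ₃ = 423/256 ≤ 3` with a mean gap `17/8 > G`; the certificate has `205` such trees, all within
`VAR-LE`) — and nothing can: `VAR-LE` is FALSE in general (CXI docstring STATUS, certificate
`gen20/ratchet`: on a window with 32 cells per binade, `N = 1`, a ratchet of `m` cycles pins the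
lower sibling with bias `−3/2` per cycle and re-misaligns the upper by an unbiased midpoint
split two binades down, so the ROOT MEAN GAP GROWS LINEARLY, `D = G(1 + m/4)` — exactly for
`m ≤ 16`, up to dyadic dust beyond — and `Var ŝₙ > n·G²/4` for `39 ≤ n ≤ 47` there).  Mean gaps
are `≥ 0` (item 2) but admit no bound uniform in `n`; a proof of `NOISE-LE` or of the law must
use the bias side.  Rules that are not monotone
(XCII's `e3m2_pyth_fails_nonmonotone`) can have negative mean gaps and are outside item 1.

References.  Stochastic monotonicity of exact SR-nearness and its closure under monotone kernels:
LXXVIII `SRMonotone` (classical stochastic order, Belzunce et al. 2016 Thm 2.2.5).  SR is NOT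
monotone realisation-wise ([ConnollyHighamMary2021, §1, p. 3]: "round to nearest is monotonic
but stochastic rounding is not"); the monotonicity here is of the outcome DISTRIBUTION and of the
mean map, which does hold.  The rules `StochasticA/B/C` are [FitzgibbonFelix2025, §2]; their
variance analysis in print ([ElararEtAl2025, §3]; [ConnollyHighamMary2021, Lem 6.3/Thm 6.4] for
exact SR) is per step and does not use monotonicity of the mean map.  Searches (corpus fts +
vector, galaxy): unit FRESHNESS-SR.md, QUESTIONS U and V.
-/

namespace Summit.Ventures.CertifiedArithmetic.LowPrec.SR

open Literature.ComputerArithmetic.ConnollyHighamMary2021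
open Finset

variable {K : Type*} [Field K] [LinearOrder K] [IsStrictOrderedRing K]

namespace LimitedBits

/-! ### 1. One limited-randomness step is stochastically monotone -/

/-- **Stochastic monotonicity of one limited-randomness SR step**: for a rule `q` mapping `[0,1]`
into `[0,1]` monotonically and a nondecreasing `f`, `c ≤ c' ⇒ E f(round_q c) ≤ E f(round_q c')`
(any finite value set, saturation included, both signs). -/
theorem stepQ_mono_arg {F : Finset K} (hF : F.Nonempty) {q : K → K}
    (hq01 : ∀ η, 0 ≤ η → η ≤ 1 → 0 ≤ q η ∧ q η ≤ 1) (hq : MonotoneOn q (Set.Icc 0 1))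
    {f : K → K} (hf : Monotone f) {c c' : K} (h : c ≤ c') :
    stepQ F q c f ≤ stepQ F q c' f := by
  have hx : clamp F c ≤ clamp F c' := clamp_mono hF h
  have hdu : dn F c ≤ up F c := dn_le_up F c
  have hdu' : dn F c' ≤ up F c' := dn_le_up F c'
  obtain ⟨p0, p1⟩ := pUpQ_mem F hq01 c
  obtain ⟨q0, q1⟩ := pUpQ_mem F hq01 c'
  rcases le_or_gt (up F c) (dn F c') with hA | hB
  · have h1 : stepQ F q c f ≤ f (up F c) := by
      unfold stepQ; have := hf hdu; nlinarith
    have h2 : f (dn F c') ≤ stepQ F q c' f := by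
      unfold stepQ; have := hf hdu'; nlinarith
    exact h1.trans ((hf hA).trans h2)
  · have hdd : dn F c ≤ dn F c' := dn_mono hF h
    have huu : up F c ≤ up F c' := up_mono hF h
    have hd : dn F c = dn F c' := by
      by_contra hne
      exact not_mem_of_between (lt_of_le_of_ne hdd hne) hB (dn_mem hF c')
    have hu : up F c = up F c' := by
      by_contra hne
      exact not_mem_of_between hB (lt_of_le_of_ne huu hne) (up_mem hF c)
    have hgap : 0 < up F c - dn F c := by rw [hd]; exact sub_pos.mpr hB
    have hp : pUp F c ≤ pUp F c' := by
      change (clamp F c - dn F c) / (up F c - dn F c)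
        ≤ (clamp F c' - dn F c') / (up F c' - dn F c')
      rw [← hd, ← hu]
      exact div_le_div_of_nonneg_right (sub_le_sub_right hx _) hgap.le
    have a0 := pUp_nonneg F c
    have a1 := pUp_le_one F c
    have b0 := pUp_nonneg F c'
    have b1 := pUp_le_one F c'
    have hpq : pUpQ F q c ≤ pUpQ F q c' := by
      unfold pUpQ; rw [← hd]
      split_ifs with h0
      · exact hq ⟨a0, a1⟩ ⟨b0, b1⟩ hp
      · have := hq (show 1 - pUp F c' ∈ Set.Icc (0 : K) 1 from ⟨by linarith, by linarith⟩)
          (show 1 - pUp F c ∈ Set.Icc (0 : K) 1 from ⟨by linarith, by linarith⟩) (by linarith)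
        linarith
    have hfd : f (dn F c) ≤ f (up F c) := hf hdu
    unfold stepQ; rw [← hd, ← hu]
    nlinarith [mul_nonneg (sub_nonneg.mpr hpq) (sub_nonneg.mpr hfd)]

/-- An expectation of a function bounded above on both candidates is bounded above. -/
theorem stepQ_le_of_le (F : Finset K) {q : K → K}
    (hq01 : ∀ η, 0 ≤ η → η ≤ 1 → 0 ≤ q η ∧ q η ≤ 1) (c : K) {f : K → K} {B : K}
    (hu : f (up F c) ≤ B) (hd : f (dn F c) ≤ B) : stepQ F q c f ≤ B := by
  obtain ⟨p0, p1⟩ := pUpQ_mem F hq01 c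
  unfold stepQ; nlinarith [mul_nonneg p0 (sub_nonneg.mpr hu), mul_nonneg (sub_nonneg.mpr p1)
    (sub_nonneg.mpr hd)]

/-! ### 2. The mean map of the accumulation is monotone; mean gaps are nonnegative -/

/-- **Monotone mean map**: for a monotone admissible rule and nondecreasing `f`,
`s ↦ E[f(ŝₙ) | ŝ₀ = s]` is nondecreasing (every `n`, every summand sequence). -/
theorem accExpQ_mono_arg {F : Finset K} (hF : F.Nonempty) {q : K → K}
    (hq01 : ∀ η, 0 ≤ η → η ≤ 1 → 0 ≤ q η ∧ q η ≤ 1) (hq : MonotoneOn q (Set.Icc 0 1)) :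
    ∀ (x : ℕ → K) (n : ℕ) {f : K → K}, Monotone f → Monotone (accExpQ F q x n f) := by
  intro x n
  induction n generalizing x with
  | zero => intro f hf a b hab; simp only [accExpQ]; exact hf hab
  | succ n ih =>
    intro f hf a b hab
    simp only [accExpQ]
    exact stepQ_mono_arg hF hq01 hq (ih _ hf) (by linarith)

/-- **Mean gaps are nonnegative**: `0 ≤ D(c) = E[ŝₙ | up c] − E[ŝₙ | dn c]` at every branch point,
for every monotone admissible rule. -/
theorem meanGap_nonneg {F : Finset K} (hF : F.Nonempty) {q : K → K}
    (hq01 : ∀ η, 0 ≤ η → η ≤ 1 → 0 ≤ q η ∧ q η ≤ 1) (hq : MonotoneOn q (Set.Icc 0 1))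
    (x : ℕ → K) (n : ℕ) (c : K) : 0 ≤ meanGap F q x n c :=
  sub_nonneg.mpr (accExpQ_mono_arg hF hq01 hq x n (fun _ _ h => h) (dn_le_up F c))

/-- CX's sibling drift gap is at least minus the cell width: `−(up c − dn c) ≤ Δ(c)`. -/
theorem neg_width_le_driftGap {F : Finset K} (hF : F.Nonempty) {q : K → K}
    (hq01 : ∀ η, 0 ≤ η → η ≤ 1 → 0 ≤ q η ∧ q η ≤ 1) (hq : MonotoneOn q (Set.Icc 0 1))
    (x : ℕ → K) (n : ℕ) (c : K) : -(up F c - dn F c) ≤ driftGap F q x n c := by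
  rw [driftGap_eq_meanGap_sub]; linarith [meanGap_nonneg hF hq01 hq x n c]

/-! ### 3. The variance conjecture on the mean-gap class and the drift-antitone class -/

/-- A node with `D ≤ G` has node variance `π(1−π)·D² ≤ G²/4`. -/
theorem nodeVar_le_of_meanGap_le {F : Finset K} (hF : F.Nonempty) {q : K → K}
    (hq01 : ∀ η, 0 ≤ η → η ≤ 1 → 0 ≤ q η ∧ q η ≤ 1) (hq : MonotoneOn q (Set.Icc 0 1))
    {G : K} (x : ℕ → K) (n : ℕ) (c : K) (hD : meanGap F q x n c ≤ G) :
    nodeVar F q x n c ≤ G ^ 2 / 4 := by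
  obtain ⟨p0, p1⟩ := pUpQ_mem F hq01 c
  have hD0 := meanGap_nonneg hF hq01 hq x n c
  have h1 : pUpQ F q c * (1 - pUpQ F q c) ≤ 1 / 4 := by
    nlinarith [sq_nonneg (pUpQ F q c - 1 / 2)]
  have h2 : meanGap F q x n c ^ 2 ≤ G ^ 2 := pow_le_pow_left₀ hD0 hD 2
  have h3 : 0 ≤ pUpQ F q c * (1 - pUpQ F q c) := mul_nonneg p0 (by linarith)
  unfold nodeVar
  calc pUpQ F q c * (1 - pUpQ F q c) * meanGap F q x n c ^ 2
      ≤ 1 / 4 * G ^ 2 := mul_le_mul h1 h2 (sq_nonneg _) (by norm_num)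
    _ = G ^ 2 / 4 := by ring

/-- **`MeanGapLE G ⇒ Var ŝₙ ≤ n·G²/4`** for every monotone admissible rule (the variance
conjecture `VAR-LE` of CXI on the mean-gap class). -/
theorem varQ_le_of_meanGapLE {F : Finset K} (hF : F.Nonempty) {q : K → K}
    (hq01 : ∀ η, 0 ≤ η → η ≤ 1 → 0 ≤ q η ∧ q η ≤ 1) (hq : MonotoneOn q (Set.Icc 0 1)) {G : K} :
    ∀ (x : ℕ → K) (n : ℕ) (s : K), MeanGapLE F q G x n s → varQ F q x n s ≤ n * (G ^ 2 / 4) := by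
  intro x n
  induction n generalizing x with
  | zero => intro s _; simp [varQ]
  | succ n ih =>
    rintro s ⟨hD, hu, hd⟩
    simp only [varQ]
    have h1 := nodeVar_le_of_meanGap_le hF hq01 hq _ _ _ hD
    have h2 : stepQ F q (s + x 0) (varQ F q (fun i => x (i + 1)) n) ≤ n * (G ^ 2 / 4) :=
      stepQ_le_of_le F hq01 _ (ih _ _ hu) (ih _ _ hd)
    push_cast; linarith

/-- **`GapLE G ∧ DriftAntitone ⇒ Var ŝₙ ≤ n·G²/4`** for every monotone admissible rule. -/
theorem varQ_le_of_driftAntitone {F : Finset K} (hF : F.Nonempty) {q : K → K}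
    (hq01 : ∀ η, 0 ≤ η → η ≤ 1 → 0 ≤ q η ∧ q η ≤ 1) (hq : MonotoneOn q (Set.Icc 0 1)) {G : K}
    (x : ℕ → K) (n : ℕ) (s : K) (hgap : GapLE F G x n s) (ha : DriftAntitone F q x n s) :
    varQ F q x n s ≤ n * (G ^ 2 / 4) :=
  varQ_le_of_meanGapLE hF hq01 hq x n s (meanGapLE_of_driftAntitone F q x n s hgap ha)

/-! ### `StochasticA`: truncation to `N` bits is a monotone rule -/

section StochasticA
variable [FloorRing K]

/-- `θ ↦ ⌊2^N θ⌋/2^N` is nondecreasing. -/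
theorem probAwayA_monotone (N : ℕ) : Monotone (probAwayA (K := K) N) := by
  intro a b hab
  unfold probAwayA
  have h2 : (0 : K) < 2 ^ N := by positivity
  exact div_le_div_of_nonneg_right
    (by exact_mod_cast Int.floor_le_floor (mul_le_mul_of_nonneg_right hab h2.le)) h2.le

/-- ... in particular on `[0,1]`. -/
theorem probAwayA_monotoneOn (N : ℕ) : MonotoneOn (probAwayA (K := K) N) (Set.Icc 0 1) :=
  (probAwayA_monotone N).monotoneOn _

/-- `StochasticA`: the mean map is monotone in the start value. -/
theorem stochasticA_accExpQ_mono {F : Finset K} (hF : F.Nonempty) (N : ℕ) (x : ℕ → K) (n : ℕ)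
    {f : K → K} (hf : Monotone f) : Monotone (accExpQ F (probAwayA N) x n f) :=
  accExpQ_mono_arg hF (probAwayA_mem N) (probAwayA_monotoneOn N) x n hf

/-- `StochasticA`: every mean gap is nonnegative. -/
theorem stochasticA_meanGap_nonneg {F : Finset K} (hF : F.Nonempty) (N : ℕ) (x : ℕ → K)
    (n : ℕ) (c : K) : 0 ≤ meanGap F (probAwayA N) x n c :=
  meanGap_nonneg hF (probAwayA_mem N) (probAwayA_monotoneOn N) x n c

/-- `StochasticA`: `MeanGapLE G ⇒ Var ŝₙ ≤ n·G²/4`. -/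
theorem stochasticA_varQ_le_of_meanGapLE {F : Finset K} (hF : F.Nonempty) (N : ℕ) {G : K}
    (x : ℕ → K) (n : ℕ) (s : K) (hm : MeanGapLE F (probAwayA N) G x n s) :
    varQ F (probAwayA N) x n s ≤ n * (G ^ 2 / 4) :=
  varQ_le_of_meanGapLE hF (probAwayA_mem N) (probAwayA_monotoneOn N) x n s hm

/-- `StochasticA`: `GapLE G ∧ DriftAntitone ⇒ Var ŝₙ ≤ n·G²/4`. -/
theorem stochasticA_varQ_le_of_driftAntitone {F : Finset K} (hF : F.Nonempty) (N : ℕ) {G : K}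
    (x : ℕ → K) (n : ℕ) (s : K) (hgap : GapLE F G x n s)
    (ha : DriftAntitone F (probAwayA N) x n s) : varQ F (probAwayA N) x n s ≤ n * (G ^ 2 / 4) :=
  varQ_le_of_driftAntitone hF (probAwayA_mem N) (probAwayA_monotoneOn N) x n s hgap ha

variable {F : Finset K} {lo hi g : K} {J : ℕ}

/-- **The variance conjecture under the `N`-binade locality condition** (CVII's class): on a
one-signed nested window with top spacing `2^J·g`, `NoSat ∧ InWindow ∧ JumpLE N ⇒
Var ŝₙ ≤ n·(2^J g)²/4` for `StochasticA` with `N` random bits. -/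
theorem varQ_le_of_jumpLE (hW : NestedWindow F lo hi g J) (hlo : 0 ≤ lo) (N : ℕ) (x : ℕ → K)
    (n : ℕ) (s : K) (hns : NoSat F x n s) (hw : InWindow F lo hi x n s)
    (hj : JumpLE F hi N x n s) : varQ F (probAwayA N) x n s ≤ n * ((2 ^ J * g) ^ 2 / 4) := by
  cases n with
  | zero => simp [varQ]
  | succ n =>
    have hF : F.Nonempty := by obtain ⟨⟨y, hy, -⟩, -⟩ := hns.1; exact ⟨y, hy⟩
    exact stochasticA_varQ_le_of_driftAntitone hF N x (n + 1) s (hW.gapLE x _ s hw)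
      (hW.driftAntitone_stochasticA_of_jumpLE hlo N x _ s hns hw hj)

/-- **Bits ≥ binades** (XCIV's regime): `J ≤ N ⇒ Var ŝₙ ≤ n·(2^J g)²/4` on every tree in the
window. -/
theorem varQ_le_of_le (hW : NestedWindow F lo hi g J) (hlo : 0 ≤ lo) {N : ℕ} (hJN : J ≤ N)
    (x : ℕ → K) (n : ℕ) (s : K) (hns : NoSat F x n s) (hw : InWindow F lo hi x n s) :
    varQ F (probAwayA N) x n s ≤ n * ((2 ^ J * g) ^ 2 / 4) :=
  varQ_le_of_jumpLE hW hlo N x n s hns hw (hW.jumpLE_of_le hJN x n s hns hw)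

end StochasticA
end LimitedBits

namespace Formats
open LimitedBits

/-- E3M2, two bits, CVII's descent from `28` through five binades (window `[1, 28]`, `G = 4`):
`Var ŝ₆ ≤ 24 = 6·G²/4` by `varQ_le_of_jumpLE`, and the exact value is `90111/65536`. -/
theorem e3m2_descending_twoBits_varLE :
    varQ e3m2 (probAwayA 2) (seqL [-57 / 8, -51 / 8, -7 / 2, -15 / 4, -15 / 8, -5 / 8]) 6 28 ≤ 24 ∧
    varQ e3m2 (probAwayA 2) (seqL [-57 / 8, -51 / 8, -7 / 2, -15 / 4, -15 / 8, -5 / 8]) 6 28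
      = 90111 / 65536 := by
  obtain ⟨hns, hw, hj, -, -⟩ := e3m2_descending_twoBits
  refine ⟨?_, by decide +kernel⟩
  have h := varQ_le_of_jumpLE e3m2_nested_1_28 (by norm_num) 2 _ 6 28 hns hw hj
  exact h.trans (by norm_num)

/-- E3M2, two bits, CX's tree `xNB` (from `2` add `57/8, −53/8, 113/16`): all three levels of mean
gaps are nonnegative (item 2) although the root gap `17/8` exceeds `G = 2` (CXI). -/
theorem e3m2_xNB_meanGaps :
    meanGap e3m2 (probAwayA 2) (fun i => xNB (i + 1)) 2 (2 + xNB 0) = 17 / 8 ∧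
    0 ≤ meanGap e3m2 (probAwayA 2) (fun i => xNB (i + 2)) 1 (up e3m2 (2 + xNB 0) + xNB 1) ∧
    0 ≤ meanGap e3m2 (probAwayA 2) (fun i => xNB (i + 2)) 1 (dn e3m2 (2 + xNB 0) + xNB 1) := by
  refine ⟨by decide +kernel, ?_, ?_⟩ <;>
    exact stochasticA_meanGap_nonneg e3m2_nonempty 2 _ 1 _

end Formats

end Summit.Ventures.CertifiedArithmetic.LowPrec.SR
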